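import Mathlib
import Summits.ValiantsHypothesis.ValiantsHypothesis.Theorems.RigidityForcesSymmetryRankRigidMinimalReprLaplaceFiveSeparatedCaptureTwoK2Hub
import Summits.ValiantsHypothesis.ValiantsHypothesis.Theorems.RigidityForcesSymmetryRankRigidMinimalReprLaplaceFiveSeparatedCaptureTwoTerm
import Summits.ValiantsHypothesis.ValiantsHypothesis.Theorems.RigidityForcesSymmetryRankRigidMinimalReprLaplaceFiveSeparatedCaptureSpanTools

/-!
# ValiantsHypothesis / RigidityForcesSymmetry — crux `LaplaceOptimalFive` (stmt-ValiantsHypothesis-24813), symmetric capture: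
# **TOOLS FOR THE `(P, P, Q)` PROFILE OF `CaptureIneqSym`** (Lemma κ, plane support, the pair read-out)

Plumbing for ★★ `finrank_le_six_of_two_equal_plus_line` (file `…SeparatedCaptureTwoEqualPlusLine`, val-port-2 g6 ↔ crit-3 g9,
2026-08-29), kept import-light so that it builds ahead of its consumer:

* `ker_symDiag_eq_zero_of_diag_ne_zero`, `symDiag_row_eq_zero` — **Lemma κ**: square-freeness of `Sym(u ⊗ s)`, i.e.
  `2 s_p u_{pr} + s_r u_{pp} = 0` for all `p, r`, forces `s = 0` when `u` has a nonzero diagonal entry, and in general forces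
  `s` to be supported on the ZERO ROWS of `u`.
* `apply_eq_zero_of_mem_of_finrank_le_two` — a plane `L ≤ ℂ⁵` containing the indicators of two letters `a ≠ b` is supported on `{a, b}`.
* `finrank_le_three_of_offpair_vanishing` — if every obligation `T_μ`, `μ ∈ W`, vanishes on the words whose first two letters avoid
  `{a, b}`, then `μ ↦ (T_μ(a, b, k))_k` embeds `W` into the indicators of `{a, b}ᶜ` (✓ `vanish_of_offpair_support`, ✓ `hub_injective`):
  `finrank W ≤ 3`.

Honest framing.  Linear-algebra plumbing only; nothing about `CaptureIneqSym`, K1, `LaplaceOptimalFive` (OPEN · CONTESTED 72/120) or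
`VP ≠ VNP` is proved here.  No definitions, no `sorry`.
-/

set_option linter.dupNamespace false
set_option autoImplicit false

namespace Summit.ValiantsHypothesis.ValiantsHypothesis.Theorems.RigidityForcesSymmetryRankRigidMinimalRepr

namespace LaplaceFiveSeparatedCapture

open Finset

/-! ### Lemma κ: square-freeness of `Sym(u ⊗ s)` -/

/-- **Lemma κ, diagonal case.**  If `u` has a nonzero diagonal entry `u q q ≠ 0`, then the only `s` with
`2 s_p u_{pr} + s_r u_{pp} = 0` for all `p, r` (square-freeness of `Sym(u ⊗ s)`) is `s = 0`. [folklore] -/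
theorem ker_symDiag_eq_zero_of_diag_ne_zero (u : Fin 5 → Fin 5 → ℂ) (q : Fin 5) (hq : u q q ≠ 0) (s : Fin 5 → ℂ)
    (hs : ∀ p r : Fin 5, s p * u p r + s p * u p r + s r * u p p = 0) : s = 0 := by
  have h1 : s q = 0 := by
    have h := hs q q
    have h3 : 3 * (s q * u q q) = 0 := by linear_combination h
    rcases mul_eq_zero.mp h3 with h3 | h3
    · norm_num at h3
    · rcases mul_eq_zero.mp h3 with h4 | h4
      · exact h4
      · exact absurd h4 hq
  funext r
  have h := hs q r
  simp only [h1, zero_mul, zero_add] at h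
  rcases mul_eq_zero.mp h with h2 | h2
  · exact h2
  · exact absurd h2 hq

/-- **Lemma κ, zero rows.**  If `u` has zero diagonal and `2 s_p u_{pr} + s_r u_{pp} = 0` for all `p, r`, then every letter `p`
with `s_p ≠ 0` indexes a ZERO ROW of `u`. [folklore] -/
theorem symDiag_row_eq_zero (u : Fin 5 → Fin 5 → ℂ) (hdiag : ∀ q, u q q = 0) (s : Fin 5 → ℂ)
    (hs : ∀ p r : Fin 5, s p * u p r + s p * u p r + s r * u p p = 0) (p : Fin 5) (hp : s p ≠ 0) (r : Fin 5) :
    u p r = 0 := by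
  have h := hs p r
  rw [hdiag p, mul_zero, add_zero] at h
  have h2 : 2 * (s p * u p r) = 0 := by linear_combination h
  rcases mul_eq_zero.mp h2 with h2 | h2
  · norm_num at h2
  · rcases mul_eq_zero.mp h2 with h3 | h3
    · exact absurd h3 hp
    · exact h3

/-- A plane `L ≤ ℂ⁵` (`finrank L ≤ 2`) containing the indicators of two distinct letters `a, b` is supported on `{a, b}`:
every `y ∈ L` vanishes off `{a, b}`. [folklore] -/
theorem apply_eq_zero_of_mem_of_finrank_le_two (L : Submodule ℂ (Fin 5 → ℂ)) (hL : Module.finrank ℂ L ≤ 2)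
    (a b : Fin 5) (hab : a ≠ b)
    (ha : (fun j : Fin 5 => if a = j then (1 : ℂ) else 0) ∈ L) (hb : (fun j : Fin 5 => if b = j then (1 : ℂ) else 0) ∈ L)
    (y : Fin 5 → ℂ) (hy : y ∈ L) (r : Fin 5) (hra : r ≠ a) (hrb : r ≠ b) : y r = 0 := by
  classical
  by_contra hne
  -- the reduced vector `y' = y − y_a e_a − y_b e_b ∈ L` vanishes at `a, b` and not at `r`
  set ea : Fin 5 → ℂ := fun j => if a = j then (1 : ℂ) else 0 with hea
  set eb : Fin 5 → ℂ := fun j => if b = j then (1 : ℂ) else 0 with heb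
  set y' : Fin 5 → ℂ := y - y a • ea - y b • eb with hy'
  have hy'L : y' ∈ L := L.sub_mem (L.sub_mem hy (L.smul_mem _ ha)) (L.smul_mem _ hb)
  have hy'a : y' a = 0 := by
    simp only [hy', hea, heb, Pi.sub_apply, Pi.smul_apply, smul_eq_mul, if_true]
    rw [if_neg (Ne.symm hab)]
    ring
  have hy'b : y' b = 0 := by
    simp only [hy', hea, heb, Pi.sub_apply, Pi.smul_apply, smul_eq_mul, if_true]
    rw [if_neg hab]
    ring
  have hy'r : y' r ≠ 0 := by
    simp only [hy', hea, heb, Pi.sub_apply, Pi.smul_apply, smul_eq_mul]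
    rw [if_neg (Ne.symm hra), if_neg (Ne.symm hrb)]
    simpa using hne
  -- the three vectors `e_a, e_b, y'` of `L` are linearly independent: contradiction with `finrank L ≤ 2`
  let f : Fin 3 → L := ![⟨ea, ha⟩, ⟨eb, hb⟩, ⟨y', hy'L⟩]
  have hf : LinearIndependent ℂ f := by
    rw [Fintype.linearIndependent_iff]
    intro g hg i
    have h0 := congrArg (fun z : L => (z : Fin 5 → ℂ)) hg
    simp only [Fin.sum_univ_three, Submodule.coe_add, Submodule.coe_smul, Submodule.coe_zero] at h0
    have hva := congrFun h0 a
    have hvb := congrFun h0 b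
    have hvr := congrFun h0 r
    simp only [f, Matrix.cons_val_zero, Matrix.cons_val_one, Matrix.cons_val_two, Matrix.tail_cons, Matrix.head_cons,
      Pi.add_apply, Pi.smul_apply, smul_eq_mul, Pi.zero_apply] at hva hvb hvr
    rw [hy'a] at hva
    rw [hy'b] at hvb
    simp only [hea, heb, if_true, if_neg hab, if_neg (Ne.symm hab), mul_one, mul_zero, add_zero, zero_add] at hva hvb
    rw [hea, heb] at hvr
    simp only [if_neg (Ne.symm hra), if_neg (Ne.symm hrb), mul_zero, zero_add] at hvr
    have hg2 : g 2 = 0 := by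
      rcases mul_eq_zero.mp hvr with h | h
      · exact h
      · exact absurd h hy'r
    fin_cases i
    · exact hva
    · exact hvb
    · exact hg2
  have hcard := hf.fintype_card_le_finrank
  simp only [Fintype.card_fin] at hcard
  omega


/-- **The pair read-out.**  If every obligation `T_μ = contractZ μ`, `μ ∈ W` (symmetric zero-diagonal leaf matrices), vanishes on all
words whose first two letters avoid `{a, b}` (`a ≠ b`), then `finrank W ≤ 3`: `μ ↦ (T_μ(a, b, k))_k` is injective
(✓ `vanish_of_offpair_support`, ✓ `hub_injective`) with image in the indicators of `{a, b}ᶜ`. [folklore] -/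
theorem finrank_le_three_of_offpair_vanishing (a b : Fin 5) (hab : a ≠ b) (W : Submodule ℂ (Fin 5 → Fin 5 → ℂ))
    (hWs : ∀ μ ∈ W, ∀ s t : Fin 5, μ s t = μ t s) (hWd : ∀ μ ∈ W, ∀ s : Fin 5, μ s s = 0)
    (hvan : ∀ μ ∈ W, ∀ p q r : Fin 5, p ≠ a → p ≠ b → q ≠ a → q ≠ b → contractZ μ p q r = 0) :
    Module.finrank ℂ W ≤ 3 := by
  classical
  let ψ : W →ₗ[ℂ] (Fin 5 → ℂ) := ((LinearMap.proj b).comp (LinearMap.proj a)).comp (cZ.domRestrict W)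
  have hψ : ∀ μ : W, ∀ k, ψ μ k = contractZ μ.1 a b k := fun μ k => rfl
  have hψinj : Function.Injective ψ := by
    rw [injective_iff_map_eq_zero]
    intro μ hμ
    have h0 : ∀ k, contractZ μ.1 a b k = 0 := fun k => by rw [← hψ, hμ, Pi.zero_apply]
    have hT0 : contractZ μ.1 = 0 := by
      funext p q r
      exact vanish_of_offpair_support (contractZ μ.1) (fun p q r => (contractZ_swap12 μ.1 p q r).symm)
        (fun p q r => (contractZ_swap23 μ.1 p q r).symm) (contractZ_rep12 μ.1) a b h0
        (fun p q r hpa hpb hqa hqb => hvan μ.1 μ.2 p q r hpa hpb hqa hqb) p q r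
    apply Subtype.ext
    refine hub_injective μ.1 (hWs μ.1 μ.2) (hWd μ.1 μ.2) fun p q => ?_
    simp [hT0]
  have hc2 : ({a, b} : Finset (Fin 5)).card = 2 := by
    rw [Finset.card_insert_of_notMem (by simp [hab]), Finset.card_singleton]
  have hψim : LinearMap.range ψ ≤
      Submodule.span ℂ (↑((({a, b} : Finset (Fin 5))ᶜ).image fun k : Fin 5 => fun j : Fin 5 => if k = j then (1 : ℂ) else 0) :
        Set (Fin 5 → ℂ)) := by
    rintro y ⟨μ, rfl⟩
    refine mem_span_indicators (ψ μ) _ fun k hk => ?_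
    rw [Finset.mem_compl, not_not] at hk
    simp only [Finset.mem_insert, Finset.mem_singleton] at hk
    rw [hψ]
    rcases hk with rfl | rfl
    · rw [← contractZ_swap23, ← contractZ_swap12]; exact contractZ_rep12 μ.1 k b
    · rw [← contractZ_swap12, ← contractZ_swap23, ← contractZ_swap12]; exact contractZ_rep12 μ.1 k a
  have hWψ : Module.finrank ℂ W = Module.finrank ℂ (LinearMap.range ψ) := (LinearMap.finrank_range_of_inj hψinj).symm
  have hcard : (({a, b} : Finset (Fin 5))ᶜ).card = 3 := by
    rw [Finset.card_compl, hc2, Fintype.card_fin]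
  have h3 := (Submodule.finrank_mono hψim).trans (finrank_span_indicators_le _)
  rw [hcard] at h3
  omega

end LaplaceFiveSeparatedCapture

end Summit.ValiantsHypothesis.ValiantsHypothesis.Theorems.RigidityForcesSymmetryRankRigidMinimalRepr
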